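import Summits.QuantumFields.BalabanUV.T4Continuum.Support.GradedWellTowerEnd
import Summits.QuantumFields.BalabanUV.T4Continuum.Spine.NE2.Targets
import Summits.QuantumFields.BalabanUV.T4Continuum.Support.GradedWellGramTwoLevel
import Summits.QuantumFields.BalabanUV.T4Continuum.Spine.NE2BalabanFinal

/-!
# T⁴ programme, spine node NE2 (U1a) — Δ1 × TIER B: ROW NE2's `TierBLaws` TRANSFER TO THE GRADED WELL and the background-perturbed
# graded-well tower END (`towerLimitRate_GW_of_tierB`, `towerLimitRate_GW_balaban`)

Cell `pub-balaban-gaps` (YM blitz, track G2, seat ne2 = spine estimate NE2; census `run/shared/lean/pub/pub-balaban-gaps/ne/NE2.md`).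
The resolvent route of the parked NE2 lineage proves ROOT B — the tower of `(Δ_a^{(k)} ⊗ 1 + t·P_k)⁻¹` — from ONE instance of
`BackgroundResolventTower.PerturbationLaws` against Bałaban's free torus operator `Δ_a ⊗ 1` (`NE2.Targets.TierBLaws`; landed for the typed `P_B(U)` as
`NE2BalabanFinal.perturbationLaws_balaban_final`).  Sub-row Δ1's graded well replaces `Δ_a` by `Δ_GW = curlᴴcurl + ∂R_GW∂ᴴ + a·Q_GWᴴQ_GW` (print's
graded absorber for an arbitrary layer map), whose free tower converges with NO displayed binder (`GradedWellTowerEnd.freeTowerLaws_GW` /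
`towerLimitRate_GW`, this cell).  THIS FILE composes the two:
 * §1 (generic, [folklore]) **`perturbationLaws_of_split`** — if `P` obeys (H-bd)/(H-cons) against `D₁` and `D₁ = D₂ + E` with `‖E·D₂⁻¹‖, ‖D₂⁻¹·E‖ ≤ ε`,
   then `P` obeys them against `D₂` with `κ(1+ε)`, `(1+ε)²e₂`; `perturbationLaws_rebase`; `opNorm_one_add_mul_mul_one_add_le`.
 * §2 the graded-well split `Δ_a ⊗ 1 = Δ_GW ⊗ 1 + E_GW ⊗ 1` with the LEVEL-FREE relative size `epsGW = eGW·γGW⁻¹`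
   (`GradedWellDifference.opNorm_EGW_le` + `GradedWellTowerCoercive.hco_GW`): **`perturbationLaws_GW_of_tierB`**.
 * §3 **`towerLimitRate_GW_of_tierB (hP : TierBLaws L M a ha P κ C₂) (ht : ‖t‖·κ(1 + ε_GW) < 1)`** — the colour-lifted background-perturbed
   graded-well tower `((Δ_GW(m+k) ⊗ 1) + t·P_{m+k})⁻¹` converges at the torus rate `L⁻¹` for ANY layer map `layer ≤ m`, explicit constant.
 * §4 **`towerLimitRate_GW_balaban`** — the instance of record: Bałaban's typed `P_B(Rg)` under EXACTLY ROOT B's binders (`hreg`, `hNE3` = node NE3 BY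
   NAME, `hκ`, `hsmall`) plus the graded-well coupling smallness `‖t‖·κ_B(1 + ε_GW) < 1` (STRONGER than ROOT B's `‖t‖κ_B < 1`; at `t = 1` it is an
   extra explicit threshold, not re-derived as an `η⋆` here).

HONEST FRAMING (T4-DAG p. 1).  MODEL LEVEL (finite torus, operator norm, King's pairing; the graded well with `m` FIXED on unit blocks — constants grow like
`L^{3m}`; `Rg` DATA, dictionary B0 asserted nowhere; NE3 displayed, OPEN); constants OURS; nothing of Bałaban's certified or disputed; NOT [B9] (3.16)/
(3.23)–(3.27)/(3.42) as printed; NE2 (U1a) NOT proved — it stays OPEN and ONE label; spine PROVED 0/9 unchanged; NOT continuum YM, NOT infinite volume /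
mass gap / Clay.  HONEST DEPENDENCY: continuum YM on T⁴ ⇐ BetaPertH ∧ nine spine estimates (0/9 proved); BetaPertH ⇐ (D1) ∧ (D4) ∧ CAP+tail; G-an2-4
gates asym, D1 and NE2/3/4.  No `sorry`; the only `def` is the constant `epsGW`.
-/

noncomputable section

open scoped BigOperators ComplexConjugate Matrix Matrix.Norms.L2Operator Kronecker

namespace Summit.QuantumFields.BalabanUV.T4Continuum.GradedWellBackground

open Literature.MathematicalPhysics.QuantumFieldTheory.Balaban1983to89.B5Prop11Plancherel (Tor fine Cst Cst_nonneg)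
open Literature.MathematicalPhysics.QuantumFieldTheory.Balaban1983to89.B5G183RateUnitTower (lev lev_neZero)
open Summit.QuantumFields.BalabanUV.T4Continuum
open Summit.QuantumFields.BalabanUV.T4Continuum.CovariantAveragingTower (TowerLimitRate)
open Summit.QuantumFields.BalabanUV.T4Continuum.BackgroundResolventTower
open Summit.QuantumFields.BalabanUV.T4Continuum.BalabanAveragedTowerUnit (idx Qlev)
open Summit.QuantumFields.BalabanUV.T4Continuum.SubtypeCompression (Coercive isUnit_det_of_coercive opNorm_inv_le_of_coercive)
open Summit.QuantumFields.BalabanUV.T4Continuum.KingPairingPlantedLaw (JpcT calDalev)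
open Summit.QuantumFields.BalabanUV.T4Continuum.KroneckerLift (kron_mul kron_inv isUnit_det_kron opNorm_kron_le_of_le freeTowerLaws_kron)
open Summit.QuantumFields.BalabanUV.T4Continuum.NE2ColourPerturbedLayer (isUnit_det_calDalev_kron)
open Summit.QuantumFields.BalabanUV.T4Continuum.NE2.Targets (TierBLaws)
open Summit.QuantumFields.BalabanUV.T4Continuum.GradedWellData
open Summit.QuantumFields.BalabanUV.T4Continuum.GradedWellTorusTransfer (EGW)
open Summit.QuantumFields.BalabanUV.T4Continuum.GradedWellGram (sigGW)
open Summit.QuantumFields.BalabanUV.T4Continuum.GradedWellGramTwoLevel (opNorm_one_sub_mul_le opNorm_one_sub_mul_mul_one_sub_le)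
open Summit.QuantumFields.BalabanUV.T4Continuum.GradedWellConsistencyTransfer (C1Tc C2GW opNorm_EGW_mul_inv_le)
open Summit.QuantumFields.BalabanUV.T4Continuum.GradedWellSandwichLaw (CSGW)
open Summit.QuantumFields.BalabanUV.T4Continuum.GradedWellDifference (eGW eGW_nonneg opNorm_EGW_le)
open Summit.QuantumFields.BalabanUV.T4Continuum.GradedWellTowerCoercive (gamGWv gamGWv_pos hco_GW)
open Summit.QuantumFields.BalabanUV.T4Continuum.GradedWellMassCommutator (CMGW)
open Summit.QuantumFields.BalabanUV.T4Continuum.GradedWellColumnsTwoLevel (CbGW)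
open Summit.QuantumFields.BalabanUV.T4Continuum.GradedWellTowerEnd (freeTowerLaws_GW inv_lt_one_of_two_le)
open Literature.MathematicalPhysics.QuantumFieldTheory.Balaban1983to89.T4EtaRateMin (LocalRate)
open Summit.QuantumFields.BalabanUV.T4Continuum.KingPairingPlantedLaw (CJ)
open Summit.QuantumFields.BalabanUV.T4Continuum.GramPerturbationLaw (C2gram)
open Summit.QuantumFields.BalabanUV.T4Continuum.NE2FromNE3 (bgReadings)
open Summit.QuantumFields.BalabanUV.T4Continuum.RegularBackgroundTower
open Summit.QuantumFields.BalabanUV.T4Continuum.CovariantAveragingSummand (kappaQ)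
open Summit.QuantumFields.BalabanUV.T4Continuum.GaugeTermPerturbationLaw (deltaK)
open Summit.QuantumFields.BalabanUV.T4Continuum.GaugeTermScalarData (QuT Q1)
open Summit.QuantumFields.BalabanUV.T4Continuum.GaugeTermInstanceGeom (gS)
open Summit.QuantumFields.BalabanUV.T4Continuum.ScalarAveragedCompression (sigma0)
open Summit.QuantumFields.BalabanUV.T4Continuum.ScalarCovariantLaplacian (kappaS)
open Summit.QuantumFields.BalabanUV.T4Continuum.NestedContourTransport (theta0)
open Summit.QuantumFields.BalabanUV.T4Continuum.RegularSiteTransporters (siteT)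
open Summit.QuantumFields.BalabanUV.T4Continuum.NE2BalabanLayer
open Summit.QuantumFields.BalabanUV.T4Continuum.NE2BalabanRoot
open Summit.QuantumFields.BalabanUV.T4Continuum.NE2BalabanGauge (gaugeSlot liftR)
open Summit.QuantumFields.BalabanUV.T4Continuum.NE2BalabanLayerSharp
open Summit.QuantumFields.BalabanUV.T4Continuum.NE2BalabanWiring
open Summit.QuantumFields.BalabanUV.T4Continuum.NE2BalabanFinal (tauR kappa4F C4F perturbationLaws_balaban_final)

/-! ## §1 Generic: `PerturbationLaws` transfer along a split `D₁ = D₂ + E` of free towers with `E` relatively small against `D₂` -/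

section Transfer

variable {ι : ℕ → Type*} [∀ k, Fintype (ι k)] [∀ k, DecidableEq (ι k)]

/-- `‖(1 + A)·Y·(1 + B)‖ ≤ (1 + ‖A‖)·‖Y‖·(1 + ‖B‖)`. [folklore] -/
theorem opNorm_one_add_mul_mul_one_add_le {n n' : Type*} [Fintype n] [DecidableEq n] [Fintype n'] [DecidableEq n']
    (A : Matrix n' n' ℂ) (Y : Matrix n' n ℂ) (B : Matrix n n ℂ) :
    ‖(1 + A) * Y * (1 + B)‖ ≤ (1 + ‖A‖) * ‖Y‖ * (1 + ‖B‖) := by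
  have h := opNorm_one_sub_mul_mul_one_sub_le (-A) Y (-B)
  rw [sub_neg_eq_add, sub_neg_eq_add, norm_neg, norm_neg] at h
  exact h

/-- **`PerturbationLaws` TRANSFER**: if `P` obeys (H-bd)/(H-cons) against a free tower `D₁` (all `D₁ k` invertible) and `D₁ = D₂ + E` with
`‖E_kD₂,k⁻¹‖, ‖D₂,k⁻¹E_k‖ ≤ ε` (all `D₂ k` invertible), then `P` obeys them against `D₂` with `κ ↦ κ(1 + ε)`, `e₂ ↦ (1 + ε)²e₂`
(`P·D₂⁻¹ = P·D₁⁻¹·(1 + E·D₂⁻¹)`, `D₂′⁻¹·Z·D₂⁻¹ = (1 + D₂′⁻¹E′)·(D₁′⁻¹·Z·D₁⁻¹)·(1 + E·D₂⁻¹)`). [folklore] -/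
theorem perturbationLaws_of_split {D₁ D₂ E P : (k : ℕ) → Matrix (ι k) (ι k) ℂ} {J : (k : ℕ) → Matrix (ι (k + 1)) (ι k) ℂ}
    {κ ε : ℝ} {e₂ : ℕ → ℝ} (h : PerturbationLaws D₁ P J κ e₂) (h₁ : ∀ k, IsUnit (D₁ k).det) (h₂ : ∀ k, IsUnit (D₂ k).det)
    (hsplit : ∀ k, D₁ k = D₂ k + E k) (hε : 0 ≤ ε)
    (hR : ∀ k, ‖E k * (D₂ k)⁻¹‖ ≤ ε) (hL : ∀ k, ‖(D₂ k)⁻¹ * E k‖ ≤ ε) :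
    PerturbationLaws D₂ P J (κ * (1 + ε)) (fun k => (1 + ε) ^ 2 * e₂ k) := by
  have hκ : 0 ≤ κ := (norm_nonneg _).trans (h.opNorm_P_mul_inv_le 0)
  have eRk : ∀ k, D₁ k * (D₂ k)⁻¹ = 1 + E k * (D₂ k)⁻¹ := fun k => by
    rw [hsplit, Matrix.add_mul, Matrix.mul_nonsing_inv _ (h₂ k)]
  have eLk : ∀ k, (D₂ k)⁻¹ * D₁ k = 1 + (D₂ k)⁻¹ * E k := fun k => by
    rw [hsplit, Matrix.mul_add, Matrix.nonsing_inv_mul _ (h₂ k)]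
  have invR : ∀ k, (D₂ k)⁻¹ = (D₁ k)⁻¹ * (1 + E k * (D₂ k)⁻¹) := fun k => by
    rw [← eRk, ← Matrix.mul_assoc, Matrix.nonsing_inv_mul _ (h₁ k), Matrix.one_mul]
  have invL : ∀ k, (D₂ k)⁻¹ = (1 + (D₂ k)⁻¹ * E k) * (D₁ k)⁻¹ := fun k => by
    rw [← eLk, Matrix.mul_assoc, Matrix.mul_nonsing_inv _ (h₁ k), Matrix.mul_one]
  refine ⟨fun k => ?_, fun k => ?_, fun k => ?_⟩
  · -- (H-bd), right
    have e : P k * (D₂ k)⁻¹ = P k * (D₁ k)⁻¹ + P k * (D₁ k)⁻¹ * (E k * (D₂ k)⁻¹) := by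
      conv_lhs => rw [invR k]
      rw [← Matrix.mul_assoc, Matrix.mul_add, Matrix.mul_one]
    rw [e]
    calc ‖P k * (D₁ k)⁻¹ + P k * (D₁ k)⁻¹ * (E k * (D₂ k)⁻¹)‖
        ≤ ‖P k * (D₁ k)⁻¹‖ + ‖P k * (D₁ k)⁻¹ * (E k * (D₂ k)⁻¹)‖ := norm_add_le _ _
      _ ≤ κ + κ * ε := add_le_add (h.opNorm_P_mul_inv_le k)
          ((Matrix.l2_opNorm_mul _ _).trans (mul_le_mul (h.opNorm_P_mul_inv_le k) (hR k) (norm_nonneg _) hκ))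
      _ = κ * (1 + ε) := by ring
  · -- (H-bd), left
    have e : (D₂ k)⁻¹ * P k = (D₁ k)⁻¹ * P k + (D₂ k)⁻¹ * E k * ((D₁ k)⁻¹ * P k) := by
      conv_lhs => rw [invL k]
      rw [Matrix.mul_assoc, Matrix.add_mul, Matrix.one_mul]
    rw [e]
    calc ‖(D₁ k)⁻¹ * P k + (D₂ k)⁻¹ * E k * ((D₁ k)⁻¹ * P k)‖
        ≤ ‖(D₁ k)⁻¹ * P k‖ + ‖(D₂ k)⁻¹ * E k * ((D₁ k)⁻¹ * P k)‖ := norm_add_le _ _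
      _ ≤ κ + ε * κ := add_le_add (h.opNorm_inv_mul_P_le k)
          ((Matrix.l2_opNorm_mul _ _).trans (mul_le_mul (hL k) (h.opNorm_inv_mul_P_le k) (norm_nonneg _) hε))
      _ = κ * (1 + ε) := by ring
  · -- (H-cons)
    have e : (D₂ (k + 1))⁻¹ * (P (k + 1) * J k - J k * P k) * (D₂ k)⁻¹
        = (1 + (D₂ (k + 1))⁻¹ * E (k + 1)) * ((D₁ (k + 1))⁻¹ * (P (k + 1) * J k - J k * P k) * (D₁ k)⁻¹)
            * (1 + E k * (D₂ k)⁻¹) := by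
      conv_lhs => rw [invL (k + 1), invR k]
      simp only [Matrix.mul_assoc]
    rw [e]
    have h0 : 0 ≤ e₂ k := (norm_nonneg _).trans (h.consistent_le k)
    calc ‖(1 + (D₂ (k + 1))⁻¹ * E (k + 1)) * ((D₁ (k + 1))⁻¹ * (P (k + 1) * J k - J k * P k) * (D₁ k)⁻¹)
            * (1 + E k * (D₂ k)⁻¹)‖
        ≤ (1 + ‖(D₂ (k + 1))⁻¹ * E (k + 1)‖) * ‖(D₁ (k + 1))⁻¹ * (P (k + 1) * J k - J k * P k) * (D₁ k)⁻¹‖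
            * (1 + ‖E k * (D₂ k)⁻¹‖) := opNorm_one_add_mul_mul_one_add_le _ _ _
      _ ≤ (1 + ε) * e₂ k * (1 + ε) :=
          mul_le_mul (mul_le_mul (by linarith [hL (k + 1)]) (h.consistent_le k) (norm_nonneg _) (by linarith))
            (by linarith [hR k]) (by positivity) (by positivity)
      _ = (1 + ε) ^ 2 * e₂ k := by ring

/-- re-basing a `PerturbationLaws` family at level `m` (levels `m + k`). [folklore] -/
theorem perturbationLaws_rebase {D P : (k : ℕ) → Matrix (ι k) (ι k) ℂ} {J : (k : ℕ) → Matrix (ι (k + 1)) (ι k) ℂ} {κ : ℝ}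
    {e₂ : ℕ → ℝ} (h : PerturbationLaws D P J κ e₂) (m : ℕ) :
    PerturbationLaws (ι := fun k => ι (m + k)) (fun k => D (m + k)) (fun k => P (m + k)) (fun k => J (m + k)) κ
      (fun k => e₂ (m + k)) :=
  ⟨fun k => h.opNorm_P_mul_inv_le (m + k), fun k => h.opNorm_inv_mul_P_le (m + k), fun k => h.consistent_le (m + k)⟩

end Transfer

/-! ## §2 The graded well versus Bałaban's torus operator: `Δ_a ⊗ 1 = Δ_GW ⊗ 1 + E_GW ⊗ 1` with `E_GW` relatively small, level-free -/

section GW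

variable {d : ℕ} (L : ℕ) [NeZero L] (M : Fin d → ℕ) [hM : ∀ μ, NeZero (M μ)] (m : ℕ) (layer : Tor M → ℕ) (a a' : ℝ)
  (o : Type*) [Fintype o] [DecidableEq o]

/-- the RELATIVE size of the graded-well difference: `ε_GW = e_GW·γ_GW⁻¹` (depends on `d, L, m, a, a′` only). [folklore] -/
def epsGW (d L m : ℕ) (a a' : ℝ) : ℝ := eGW d L m a a' * (gamGWv d L m a a')⁻¹

omit hM in
/-- `0 ≤ ε_GW`. [folklore] -/
theorem epsGW_nonneg (ha : 0 < a) (ha' : 0 < a') : 0 ≤ epsGW d L m a a' :=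
  mul_nonneg (eGW_nonneg (d := d) L m a a' ha.le ha') (inv_nonneg.mpr (gamGWv_pos (d := d) L (m := m) a a' ha').le)

/-- `‖E_k·G_GW(k)‖ ≤ ε_GW` for `k ≥ m`. [folklore] -/
theorem opNorm_EGW_mul_inv_le' (ha : 0 < a) (hL : 2 ≤ L) (hlay : ∀ y, layer y ≤ m) (ha' : 0 < a') (k : ℕ) (hk : m ≤ k) :
    ‖EGW L M k m layer a a' ha * (regionGW L M k m layer a a')⁻¹‖ ≤ epsGW d L m a a' :=
  opNorm_EGW_mul_inv_le L M k m layer a a' ha (gamGWv_pos (d := d) L (m := m) a a' ha') (eGW_nonneg (d := d) L m a a' ha.le ha')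
    (hco_GW L M m layer a a' ha hL hlay ha' k hk) (opNorm_EGW_le L M m layer a a' ha hlay ha' k)

/-- `‖G_GW(k)·E_k‖ ≤ ε_GW` for `k ≥ m`. [folklore] -/
theorem opNorm_inv_mul_EGW_le (ha : 0 < a) (hL : 2 ≤ L) (hlay : ∀ y, layer y ≤ m) (ha' : 0 < a') (k : ℕ) (hk : m ≤ k) :
    ‖(regionGW L M k m layer a a')⁻¹ * EGW L M k m layer a a' ha‖ ≤ epsGW d L m a a' := by
  unfold epsGW
  rw [mul_comm]
  exact (Matrix.l2_opNorm_mul _ _).trans (mul_le_mul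
    (opNorm_inv_le_of_coercive (gamGWv_pos (d := d) L (m := m) a a' ha') (hco_GW L M m layer a a' ha hL hlay ha' k hk))
    (opNorm_EGW_le L M m layer a a' ha hlay ha' k) (norm_nonneg _)
    (inv_nonneg.mpr (gamGWv_pos (d := d) L (m := m) a a' ha').le))

/-- **ROW NE2's `TierBLaws` TRANSFER TO THE GRADED WELL**: a perturbation family obeying (H-bd)/(H-cons) against `Δ_a^{(k)} ⊗ 1` with `κ`, `C₂L^{−k}`
obeys them against the colour-lifted graded-well tower re-based at level `m`, with `κ(1 + ε_GW)` and `(1 + ε_GW)²·C₂L^{−(m+k)}`. [folklore] -/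
theorem perturbationLaws_GW_of_tierB (ha : 0 < a) (hL : 2 ≤ L) (hlay : ∀ y, layer y ≤ m) (ha' : 0 < a')
    {P : (k : ℕ) → Matrix (idx L M k × o) (idx L M k × o) ℂ} {κ C₂ : ℝ} (hP : TierBLaws L M a ha P κ C₂) :
    PerturbationLaws (ι := fun k => idx L M (m + k) × o) (fun k => regionGW L M (m + k) m layer a a' ⊗ₖ (1 : Matrix o o ℂ))
      (fun k => P (m + k)) (fun k => JpcT L M (m + k) ⊗ₖ (1 : Matrix o o ℂ)) (κ * (1 + epsGW d L m a a'))
      (fun k => (1 + epsGW d L m a a') ^ 2 * (C₂ * ((L : ℝ)⁻¹) ^ (m + k))) := by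
  have hγ := gamGWv_pos (d := d) L (m := m) a a' ha'
  refine perturbationLaws_of_split (E := fun k => EGW L M (m + k) m layer a a' ha ⊗ₖ (1 : Matrix o o ℂ))
    (perturbationLaws_rebase hP m) (fun k => isUnit_det_calDalev_kron L M a ha (m + k))
    (fun k => isUnit_det_kron o (isUnit_det_of_coercive hγ (hco_GW L M m layer a a' ha hL hlay ha' (m + k) (Nat.le_add_right m k))))
    (fun k => ?_) (epsGW_nonneg L m a a' ha ha') (fun k => ?_) (fun k => ?_)
  · show calDalev L M a ha (m + k) ⊗ₖ (1 : Matrix o o ℂ) = _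
    rw [← Matrix.add_kronecker]
    congr 1
    unfold EGW
    abel
  · rw [kron_inv, ← kron_mul]
    exact opNorm_kron_le_of_le o (opNorm_EGW_mul_inv_le' L M m layer a a' ha hL hlay ha' (m + k) (Nat.le_add_right m k))
  · rw [kron_inv, ← kron_mul]
    exact opNorm_kron_le_of_le o (opNorm_inv_mul_EGW_le L M m layer a a' ha hL hlay ha' (m + k) (Nat.le_add_right m k))

/-! ## §3 THE END: the background-perturbed graded-well tower under row NE2's `TierBLaws` -/

/-- **NE2⁺ OVER THE GRADED WELL AT MODEL LEVEL — `TierBLaws ⟹` the colour-lifted, background-PERTURBED graded-well propagators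
`((Δ_GW(m+k) ⊗ 1) + t·P_{m+k})⁻¹` have King-averaged unit-lattice images converging at the TORUS RATE `L⁻¹`**, for ANY layer map `layer ≤ m`
(any region geometry), any perturbation family `P` in row NE2's tier-B class (`NE2.Targets.TierBLaws L M a ha P κ C₂`: (H-bd)/(H-cons) against
`Δ_a ⊗ 1` — the hypothesis of ROOT B, landed for Bałaban's typed `P_B(U)` as `NE2BalabanFinal.perturbationLaws_balaban_final` under `hreg`/`hNE3`/
smallness) and every coupling with `‖t‖·κ(1 + ε_GW) < 1`.  The Δ1 × tier-B composition: `freeTowerLaws_GW` (this cell, no binder) ⊗ colour +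
`perturbationLaws_GW_of_tierB` + the resolvent route `towerLimitRate_perturbed`.  MODEL LEVEL (`m` fixed, unit blocks, finite torus, operator norm);
the smallness is STRONGER than ROOT B's (`κ(1+ε_GW) < 1` instead of `κ < 1`); NOT [B9] as printed; NE2 (U1a) NOT proved; spine PROVED 0/9 unchanged.
[cite: Balaban1985BackgroundPropagators, (3.23)–(3.27) pp.394–395 (shapes); King1986, Lemma 4.5 (4.38) p.674 (shape: rate L^{−k})] [folklore] -/
theorem towerLimitRate_GW_of_tierB (ha : 0 < a) (hd : 1 ≤ d) (hL : 2 ≤ L) (hlay : ∀ y, layer y ≤ m) (ha' : 0 < a')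
    {P : (k : ℕ) → Matrix (idx L M k × o) (idx L M k × o) ℂ} {κ C₂ : ℝ} (hP : TierBLaws L M a ha P κ C₂)
    {t : ℂ} (ht : ‖t‖ * (κ * (1 + epsGW d L m a a')) < 1) :
    TowerLimitRate (ι := fun k => idx L M (m + k) × o) (fun k => Qlev L M (m + k) ⊗ₖ (1 : Matrix o o ℂ)) ((L : ℝ) ^ d)
      (fun k => (regionGW L M (m + k) m layer a a' ⊗ₖ (1 : Matrix o o ℂ) + t • P (m + k))⁻¹)
      (Cpert (κ * (1 + epsGW d L m a a'))
        ((1 + (gamGWv d L m a a')⁻¹ * eGW d L m a a') * (2 * d * Cst d a) * ((L : ℝ)⁻¹) ^ m)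
        (C1Tc d a (gamGWv d L m a a') (eGW d L m a a')
          (C2GW d L a (Cst d a ^ 2 * CMGW L m) (Cst d a ^ 2 * CSGW d L m a' (CbGW d L m a'))) * ((L : ℝ)⁻¹) ^ m)
        ((1 + epsGW d L m a a') ^ 2 * (C₂ * ((L : ℝ)⁻¹) ^ m)) 0 t)
      ((L : ℝ)⁻¹) := by
  have hr : (0 : ℝ) < (L : ℝ) ^ d := pow_pos (by exact_mod_cast Nat.pos_of_ne_zero (NeZero.ne L)) d
  exact towerLimitRate_perturbed hr (freeTowerLaws_kron o (freeTowerLaws_GW L M m layer a a' ha hd hL hlay ha'))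
    (perturbationLaws_GW_of_tierB L M m layer a a' o ha hL hlay ha' hP) (inv_lt_one_of_two_le L hL)
    (fun k => le_of_eq (by rw [pow_add]; ring)) (fun k => le_of_eq (by rw [pow_add]; ring))
    (fun k => le_of_eq (by rw [pow_add]; ring)) (fun _ => by simp) ht


/-! ## §4 The instance of record: Bałaban's typed tier-B operator over the graded well (ROOT B's binders + the graded-well smallness) -/

/-- **BAŁABAN's TYPED `P_B(U)` OVER THE GRADED WELL**: for site-based bond transporters `Rg` in row B5's (3.35)-shape class (`hreg`), node NE3's
`LocalRate` BY NAME (`hNE3`, OPEN), the gauge-term parameter `b′ > 0` and ROOT B's two smallness conditions (`hκ`, `hsmall` of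
`NE2BalabanFinal.perturbationLaws_balaban_final`), and a coupling with `‖t‖·κ_B(1 + ε_GW) < 1`: the King-averaged colour-lifted unit-lattice images of
`((Δ_GW(m+k) ⊗ 1) + t·P_B(Rg)_{m+k})⁻¹` converge at rate `L⁻¹`, for ANY layer map `layer ≤ m`.  The Δ1 × tier-B END of the model: NE2⁺ for arbitrary
region geometry, CONDITIONAL on NE3 exactly as ROOT B is.  Displayed binders: `hreg`, `hNE3`, `hκ`, `hsmall`, `ht`, `0 < a`, `1 ≤ d`, `2 ≤ L`,
`layer ≤ m`, `0 < a′`, `0 < b′` — nothing else.  MODEL LEVEL; dictionary B0 asserted nowhere; NE2 (U1a) NOT proved; spine PROVED 0/9 unchanged.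
[cite: Balaban1985BackgroundPropagators, (3.23)–(3.27) pp.394–395, (3.35) p.396 (shapes)] [folklore] -/
theorem towerLimitRate_GW_balaban (ha : 0 < a) (hd : 1 ≤ d) (hL : 2 ≤ L) (hlay : ∀ y, layer y ≤ m) (ha' : 0 < a')
    {Rg : (k : ℕ) → Fin d → (Tor (fine (lev L k) M) → Matrix o o ℂ)} {α β : ℝ} (hreg : RegularTransporters L M (liftR L M Rg) α β)
    {C : ℝ} (hC : 0 ≤ C) (hNE3 : LocalRate (bgReadings L M (regClass L M (liftR L M Rg))) C ((L : ℝ)⁻¹)) {b' : ℝ} (hb' : 0 < b')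
    (hκ : kappaS d b' α β (tauR d α) < 1)
    (hsmall : ((sigma0 d b') ^ 2)⁻¹ * deltaK (gS d b' (kappaS d b' α β (tauR d α))) (1 + tauR d α) (d * α) (tauR d α) b' < 1)
    {t : ℂ} (ht : ‖t‖ * (kappaBs o d a α β (kappaQ d a (a : ℂ) (epsR o d α)) (kappa4F d a b' α β) * (1 + epsGW d L m a a')) < 1) :
    TowerLimitRate (ι := fun k => idx L M (m + k) × o) (fun k => Qlev L M (m + k) ⊗ₖ (1 : Matrix o o ℂ)) ((L : ℝ) ^ d)
      (fun k => (regionGW L M (m + k) m layer a a' ⊗ₖ (1 : Matrix o o ℂ)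
        + t • balabanPert L M a (liftR L M Rg) (gaugeSlot L M Rg (QuT L M o (siteT L M Rg)) (Q1 L M o) b') (m + k))⁻¹)
      (Cpert (kappaBs o d a α β (kappaQ d a (a : ℂ) (epsR o d α)) (kappa4F d a b' α β) * (1 + epsGW d L m a a'))
        ((1 + (gamGWv d L m a a')⁻¹ * eGW d L m a a') * (2 * d * Cst d a) * ((L : ℝ)⁻¹) ^ m)
        (C1Tc d a (gamGWv d L m a a') (eGW d L m a a')
          (C2GW d L a (Cst d a ^ 2 * CMGW L m) (Cst d a ^ 2 * CSGW d L m a' (CbGW d L m a'))) * ((L : ℝ)⁻¹) ^ m)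
        ((1 + epsGW d L m a a') ^ 2 * (C2Bs o d L a α β C
          (a * C2gram (Cst d a) 1 (epsR o d α) (2 * d * Cst d a) (CJ d a) (Cst d a) (CdeltaR o d a α (theta0 d α (betaNE3 o C))))
          (C4F o d L a b' α β C) * ((L : ℝ)⁻¹) ^ m)) 0 t)
      ((L : ℝ)⁻¹) :=
  towerLimitRate_GW_of_tierB L M m layer a a' o ha hd hL hlay ha'
    (perturbationLaws_balaban_final L M a ha hd hreg hC hNE3 hb' hκ hsmall) ht

end GW

end Summit.QuantumFields.BalabanUV.T4Continuum.GradedWellBackground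

end
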